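import Summits.BirchSwinnertonDyer.BirchSwinnertonDyer.Theorems.ManinLocalTwoThreeUnboundedDenominatorsWeightOfCDT
import HarnessLib

/-!
# Unbounded Denominators with ALGEBRAIC-INTEGER coefficients, unbundled: an's `UnboundedDenominatorsWeightAlgInt k` from the tree's
# vendored fact `CalegariDimitrovTang2025_unboundedDenominators_algInt` (route `ManinLocalTwoThree`, crux C3 `ManinPrimeToThreeAtNine`
# stmt-BirchSwinnertonDyer-22968 — the `K`-rational Kummer/UDC line for the residual RES₃♭, -an g39 MEMO-an §82; cell bsd-f2-manin, p2 gen 18;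
# `--supports stmt-BirchSwinnertonDyer-22968`)

-an g39's `K`-line (HOME/an/g39/UDCKummerLineK-an-g39.lean, to land as `…ManinAdditive.UDCKummerLineK`, ask T-an-47) splits the residual
RES₃♭ of C3 as EXISTC ∧ GENΣ ∧ KLINE ∧ RESΣ with KLINE ⟸ (NCΣ) ∧ (BI)_K ∧ (AN)_K and (AN)_K ⟸ (AN♮)_K ∧ `∀ k, UnboundedDenominatorsWeightAlgInt k`,
the printed input being the Unbounded Denominators theorem for a width-one `q`-expansion with ALGEBRAIC-INTEGER coefficients in the cell's
UNBUNDLED rendering (holomorphic `F : ℍ → ℂ`, weight-`k` invariant under a finite-index `Γ ≤ SL(2, ℤ)`, exponential growth of every slash,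
`F = Σ bₙ e^{2πiτn}` on `ℍ` with every `bₙ` an algebraic integer ⟹ `F` is `Γ(M)`-invariant for some `M ≥ 1`).  The tree vendors CDT's
Remarks 58–59 in the HOLOMORPHIC-at-the-cusps bundled form `Literature.NumberTheory.Automorphic.CalegariDimitrovTang2025_unboundedDenominators_algInt`
(Mathlib `ModularForm Γ k`, `IsIntegral ℤ` coefficients of `qExpansion h`).  This file proves the passage, re-running p2's `Δ`-power argument of
`UDWOfCDT.unboundedDenominatorsWeight_of_CDT` (p726609) with `IsIntegral ℤ` in place of `ℤ`:

* **`unboundedDenominatorsWeightAlgInt_of_CDT_algInt`** — the statement is the body of an's `UnboundedDenominatorsWeightAlgInt k` VERBATIM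
  (stated inline: the `ManinAdditive` statement file is not in the tree yet; the by-name corollary is one line once it lands).

PROOF.  As in p726609: `F(τ+1) = F(τ)` from the width-one series; `f := F·Δ^{k′}` with `k′ ≥` every cusp exponent is a `ModularForm K (k + 12k′)` for the
stabiliser `K ⊇ Γ ∪ {T}`; its `qExpansion 1` is the Cauchy product of `Σ bₙqⁿ` with the INTEGER series of `Δ^{k′}`, whose coefficients are algebraic
integers (`IsIntegral` is closed under sums and products: `IsIntegral.add/.mul`, `isIntegral_algebraMap`); the vendored fact gives `Γ(M)`-invariance of
`f`, and dividing by `Δ^{k′} ≠ 0` that of `F`.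

HONEST FRAMING.  A REDUCTION between two renderings of ONE printed theorem (no new mathematics); (AN♮)_K, KLINE, RES₃♭, C3, Manin's conjecture and
BSD are NOT proved here. [cite: CalegariDimitrovTang2025, Thm. 1.0.1 and Remarks 58–59 (arXiv:2109.09040 numbering)]
-/

set_option autoImplicit false
-- lint-debt: the directory name repeats the summit name (sibling precedent `ManinLocalTwoThreeUnboundedDenominatorsWeightOfCDT.lean`)
set_option linter.dupNamespace false

noncomputable section

open scoped MatrixGroups ModularForm Manifold Topology
open Complex UpperHalfPlane CongruenceSubgroup PowerSeries Filter Asymptotics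
open Literature.NumberTheory.Automorphic

namespace Summit.BirchSwinnertonDyer.BirchSwinnertonDyer.Theorems.ManinLocalTwoThree.UDWOfCDT

/-! ### §1 Two small lemmas: width-one periodicity for complex coefficients; algebraic integrality of a Cauchy product -/

/-- A function with a width-`1` Fourier series (complex coefficients) is `1`-periodic: `F(T•τ) = F(τ)`. [folklore] -/
theorem apply_T_smul_of_hasSum_complex {F : ℍ → ℂ} {b : ℕ → ℂ}
    (hb : ∀ τ : ℍ, HasSum (fun n : ℕ ↦ b n * cexp (2 * Real.pi * Complex.I * (τ : ℂ) * n)) (F τ)) (τ : ℍ) :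
    F (ModularGroup.T • τ) = F τ := by
  have hT : (((ModularGroup.T • τ : ℍ)) : ℂ) = 1 + (τ : ℂ) := by
    rw [UpperHalfPlane.modular_T_smul, UpperHalfPlane.coe_vadd]; push_cast; ring
  have h1 := hb (ModularGroup.T • τ)
  have h2 := hb τ
  have heq : (fun n : ℕ ↦ b n * cexp (2 * Real.pi * Complex.I * (((ModularGroup.T • τ : ℍ)) : ℂ) * n)) =
      fun n : ℕ ↦ b n * cexp (2 * Real.pi * Complex.I * (τ : ℂ) * n) := by
    funext n
    rw [hT, show 2 * (Real.pi : ℂ) * Complex.I * (1 + (τ : ℂ)) * n =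
        2 * Real.pi * Complex.I * τ * n + n * (2 * Real.pi * Complex.I) by ring,
      Complex.exp_add, Complex.exp_nat_mul_two_pi_mul_I, mul_one]
  rw [heq] at h1
  exact h1.unique h2

/-- The coefficients of (a series with algebraic-integer coefficients) × (the image of an integer series) are algebraic integers. [folklore] -/
theorem isIntegral_coeff_mul_map {B : PowerSeries ℂ} (hB : ∀ n, IsIntegral ℤ (coeff n B)) (D : PowerSeries ℤ) (n : ℕ) :
    IsIntegral ℤ (coeff n (B * PowerSeries.map (Int.castRingHom ℂ) D)) := by
  rw [PowerSeries.coeff_mul]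
  refine IsIntegral.sum _ fun ij _ ↦ (hB ij.1).mul ?_
  rw [PowerSeries.coeff_map, eq_intCast]
  exact isIntegral_algebraMap (R := ℤ) (A := ℂ) (x := coeff ij.2 D)

/-! ### §2 The bridge (algebraic-integer coefficients) -/

/-- **an's `UnboundedDenominatorsWeightAlgInt k` (body VERBATIM) from the vendored CDT fact with algebraic-integer coefficients**
(proof in the module docstring). [cite: CalegariDimitrovTang2025, Thm. 1.0.1 and Remarks 58–59] -/
theorem unboundedDenominatorsWeightAlgInt_of_CDT_algInt (hCDT : CalegariDimitrovTang2025_unboundedDenominators_algInt) (k : ℤ) :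
    ∀ (Γ : Subgroup SL(2, ℤ)), Γ.FiniteIndex → ∀ F : ℍ → ℂ, MDifferentiable 𝓘(ℂ) 𝓘(ℂ) F →
    (∀ γ ∈ Γ, F ∣[k] γ = F) →
    (∀ g : SL(2, ℤ), ∃ C A m : ℝ, ∀ τ : ℍ, A ≤ τ.im → ‖(F ∣[k] g) τ‖ ≤ C * Real.exp (m * τ.im)) →
    (∃ b : ℕ → ℂ, (∀ n, _root_.IsIntegral ℤ (b n)) ∧ ∀ τ : ℍ,
      HasSum (fun n : ℕ => b n * Complex.exp (2 * Real.pi * Complex.I * (τ : ℂ) * n)) (F τ)) →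
    ∃ M : ℕ, 0 < M ∧ ∀ γ ∈ CongruenceSubgroup.Gamma M, F ∣[k] γ = F := by
  intro Γ hΓfi F hF hinv hgrowth hser
  haveI := hΓfi
  obtain ⟨b, hbint, hb⟩ := hser
  classical
  -- §a the uniform exponent `k′` over the finitely many cosets of `Γ`
  choose C A m hCAm using hgrowth
  haveI : Finite (SL(2, ℤ) ⧸ Γ) := Subgroup.finite_quotient_of_finiteIndex
  haveI : Fintype (SL(2, ℤ) ⧸ Γ) := Fintype.ofFinite _
  let kq : SL(2, ℤ) ⧸ Γ → ℕ := fun q ↦ ⌈m (q.out)⁻¹⌉₊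
  let k' : ℕ := ∑ q, kq q
  have hk' : ∀ q : SL(2, ℤ) ⧸ Γ, m (q.out)⁻¹ ≤ (k' : ℝ) := by
    intro q
    have h1 : m (q.out)⁻¹ ≤ (kq q : ℝ) := Nat.le_ceil _
    have h2 : kq q ≤ k' := Finset.single_le_sum (fun _ _ ↦ Nat.zero_le _) (Finset.mem_univ q)
    exact h1.trans (by exact_mod_cast h2)
  have hgrow : ∀ g : SL(2, ℤ), ∃ C₀ A₀ : ℝ, ∀ τ : ℍ, A₀ ≤ τ.im →
      ‖(F ∣[k] g) τ‖ ≤ C₀ * Real.exp ((k' : ℝ) * τ.im) := by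
    intro g
    set q : SL(2, ℤ) ⧸ Γ := QuotientGroup.mk (g⁻¹) with hq
    obtain ⟨h, hh⟩ := QuotientGroup.mk_out_eq_mul (s := Γ) (g⁻¹)
    have hrep : F ∣[k] (q.out)⁻¹ = F ∣[k] g := by
      rw [hq, hh, mul_inv_rev, inv_inv, SlashAction.slash_mul, hinv _ (inv_mem h.2)]
    refine ⟨max (C (q.out)⁻¹) 0, A (q.out)⁻¹, fun τ hτ ↦ ?_⟩
    have h1 := hCAm (q.out)⁻¹ τ hτ
    rw [hrep] at h1
    refine h1.trans ?_
    have hexp : Real.exp (m (q.out)⁻¹ * τ.im) ≤ Real.exp ((k' : ℝ) * τ.im) :=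
      Real.exp_le_exp.mpr (mul_le_mul_of_nonneg_right (hk' q) τ.im_pos.le)
    calc C (q.out)⁻¹ * Real.exp (m (q.out)⁻¹ * τ.im)
        ≤ max (C (q.out)⁻¹) 0 * Real.exp (m (q.out)⁻¹ * τ.im) :=
          mul_le_mul_of_nonneg_right (le_max_left _ _) (Real.exp_pos _).le
      _ ≤ max (C (q.out)⁻¹) 0 * Real.exp ((k' : ℝ) * τ.im) :=
          mul_le_mul_of_nonneg_left hexp (le_max_right _ _)
  -- §b the function `f = F·Δ^{k′}` and its stabiliser `K`
  set Dk : ℍ → ℂ := fun τ ↦ ModularForm.discriminant τ ^ k' with hDk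
  set f : ℍ → ℂ := fun τ ↦ F τ * ModularForm.discriminant τ ^ k' with hfdef
  have hfmul : f = F * Dk := by funext τ; simp [hfdef, hDk]
  have hfslash : ∀ g : SL(2, ℤ), f ∣[k + 12 * (k' : ℤ)] g = (F ∣[k] g) * Dk := by
    intro g
    rw [hfmul, ModularForm.mul_slash_SL2, hDk, discriminant_pow_slash k' g]
  let K : Subgroup SL(2, ℤ) :=
    { carrier := {γ | f ∣[k + 12 * (k' : ℤ)] γ = f}
      mul_mem' := fun {a b} ha hb ↦ by
        simp only [Set.mem_setOf_eq] at ha hb ⊢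
        rw [SlashAction.slash_mul, ha, hb]
      one_mem' := by
        simp only [Set.mem_setOf_eq]
        exact SlashAction.slash_one _ _
      inv_mem' := fun {a} ha ↦ by
        simp only [Set.mem_setOf_eq] at ha ⊢
        have h := SlashAction.slash_mul (k + 12 * (k' : ℤ)) a a⁻¹ f
        rw [mul_inv_cancel, SlashAction.slash_one, ha] at h
        exact h.symm }
  have hmemK : ∀ γ : SL(2, ℤ), γ ∈ K ↔ f ∣[k + 12 * (k' : ℤ)] γ = f := fun _ ↦ Iff.rfl
  have hΓK : Γ ≤ K := by
    intro γ hγ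
    rw [hmemK, hfslash, hinv γ hγ, hfmul]
  have hTK : ModularGroup.T ∈ K := by
    rw [hmemK]
    have hFT : F ∣[k] ModularGroup.T = F := by
      funext τ
      rw [ModularForm.SL_slash_apply, apply_T_smul_of_hasSum_complex hb τ]
      have : denom ModularGroup.T τ = 1 := by
        rw [ModularGroup.denom_apply]
        simp [ModularGroup.coe_T]
      rw [this]
      simp
    rw [hfslash, hFT, hfmul]
  haveI hKfi : K.FiniteIndex := Subgroup.finiteIndex_of_le hΓK
  have h1K : (1 : ℝ) ∈ (K : Subgroup (GL (Fin 2) ℝ)).strictPeriods := by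
    have h := mem_strictPeriods_of_T_pow_mem (Γ := K) (n := 1) (by rw [pow_one]; exact hTK)
    simpa using h
  -- §c holomorphy and boundedness at every cusp: `f : ModularForm K (k + 12k′)`
  obtain ⟨CΔ, AΔ, hCΔ, hΔ⟩ := exists_norm_discriminant_le
  have hΔholo : MDiff (ModularForm.discriminant : ℍ → ℂ) := (CuspForm.discriminant).holo'
  have hfholo : MDiff f := by
    rw [hfmul, hDk]
    exact hF.mul (hΔholo.pow k')
  have hfbdd : ∀ g : SL(2, ℤ), IsBoundedAtImInfty (f ∣[k + 12 * (k' : ℤ)] g) := by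
    intro g
    obtain ⟨C₀, A₀, hg⟩ := hgrow g
    rw [hfslash, UpperHalfPlane.isBoundedAtImInfty_iff]
    refine ⟨max C₀ 0 * CΔ ^ k', max (max A₀ AΔ) 0, fun τ hτ ↦ ?_⟩
    have hA₀ : A₀ ≤ τ.im := (le_max_left _ _).trans ((le_max_left _ _).trans hτ)
    have hAΔ : AΔ ≤ τ.im := (le_max_right _ _).trans ((le_max_left _ _).trans hτ)
    have hF1 : ‖(F ∣[k] g) τ‖ ≤ max C₀ 0 * Real.exp ((k' : ℝ) * τ.im) :=
      (hg τ hA₀).trans (mul_le_mul_of_nonneg_right (le_max_left _ _) (Real.exp_pos _).le)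
    have hD1 : ‖Dk τ‖ ≤ CΔ ^ k' * Real.exp (-(2 * Real.pi * (k' : ℝ) * τ.im)) := by
      rw [hDk]
      simp only [norm_pow]
      calc ‖ModularForm.discriminant τ‖ ^ k'
          ≤ (CΔ * Real.exp (-2 * Real.pi * τ.im)) ^ k' :=
            pow_le_pow_left₀ (norm_nonneg _) (hΔ τ hAΔ) k'
        _ = CΔ ^ k' * Real.exp (-(2 * Real.pi * (k' : ℝ) * τ.im)) := by
            rw [mul_pow, ← Real.exp_nat_mul]; congr 1; ring_nf
    rw [Pi.mul_apply, norm_mul]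
    calc ‖(F ∣[k] g) τ‖ * ‖Dk τ‖
        ≤ (max C₀ 0 * Real.exp ((k' : ℝ) * τ.im)) * (CΔ ^ k' * Real.exp (-(2 * Real.pi * (k' : ℝ) * τ.im))) :=
          mul_le_mul hF1 hD1 (norm_nonneg _) (mul_nonneg (le_max_right _ _) (Real.exp_pos _).le)
      _ = max C₀ 0 * CΔ ^ k' * Real.exp (((k' : ℝ) - 2 * Real.pi * k') * τ.im) := by
          rw [show ((k' : ℝ) - 2 * Real.pi * k') * τ.im = (k' : ℝ) * τ.im + -(2 * Real.pi * (k' : ℝ) * τ.im) by ring,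
            Real.exp_add]; ring
      _ ≤ max C₀ 0 * CΔ ^ k' * 1 := by
          refine mul_le_mul_of_nonneg_left ?_ (mul_nonneg (le_max_right _ _) (pow_nonneg hCΔ _))
          rw [Real.exp_le_one_iff]
          have hπ : (1 : ℝ) ≤ 2 * Real.pi := by nlinarith [Real.pi_gt_three]
          have : ((k' : ℝ) - 2 * Real.pi * k') ≤ 0 := by nlinarith [(Nat.cast_nonneg k' : (0 : ℝ) ≤ k')]
          exact mul_nonpos_of_nonpos_of_nonneg this τ.im_pos.le
      _ = max C₀ 0 * CΔ ^ k' := mul_one _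
  let fK : ModularForm (K : Subgroup (GL (Fin 2) ℝ)) (k + 12 * (k' : ℤ)) :=
    { toFun := f
      slash_action_eq' := by
        intro γ hγ
        obtain ⟨γ₀, hγ₀, rfl⟩ := Subgroup.mem_map.mp hγ
        exact (hmemK γ₀).mp hγ₀
      holo' := hfholo
      bdd_at_cusps' := by
        intro c hc
        rw [Subgroup.IsArithmetic.isCusp_iff_isCusp_SL2Z] at hc
        rw [OnePoint.isBoundedAt_iff_forall_SL2Z hc]
        intro g _
        exact hfbdd g }
  -- §d algebraic-integer `q`-expansion at period `1`
  obtain ⟨DZ, hDZ⟩ := exists_discriminant_qExpansion_eq_map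
  set B : PowerSeries ℂ := PowerSeries.mk b with hB
  have hBint : ∀ n, IsIntegral ℤ (coeff n B) := fun n ↦ by rw [hB, PowerSeries.coeff_mk]; exact hbint n
  have hsumf : ∀ τ : ℍ, HasSum (fun n : ℕ ↦
      (coeff n (B * PowerSeries.map (Int.castRingHom ℂ) (DZ ^ k'))) • Function.Periodic.qParam 1 (τ : ℂ) ^ n) (fK τ) := by
    intro τ
    have hFτ : HasSum (fun n : ℕ ↦ coeff n B * Function.Periodic.qParam 1 (τ : ℂ) ^ n) (F τ) := by
      convert hb τ using 1
      funext n
      rw [hB, PowerSeries.coeff_mk, qParam_one_pow]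
    have hprod := Summit.BirchSwinnertonDyer.BirchSwinnertonDyer.Theorems.ManinLocalTwoThree.KummerCubeSigmaLeaves.hasSum_coeff_mul_pow_mul
      hFτ (hasSum_discriminant_pow DZ hDZ k' τ)
    convert hprod using 1
    · funext n
      rw [smul_eq_mul, map_pow]
    · show f τ = _
      rw [hfdef]
  have hint : ∀ n : ℕ, IsIntegral ℤ (coeff n (qExpansion ((1 : ℕ) : ℝ) fK)) := by
    intro n
    have h := ModularFormClass.qExpansion_coeff_unique (Γ := (K : Subgroup (GL (Fin 2) ℝ)))
      (c := fun n ↦ coeff n (B * PowerSeries.map (Int.castRingHom ℂ) (DZ ^ k')))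
      one_pos h1K (f := fK) hsumf n
    rw [Nat.cast_one, ← h]
    exact isIntegral_coeff_mul_map hBint (DZ ^ k') n
  -- §e the vendored fact, then unbundling to `Γ(M)`-invariance
  have h1K' : (((1 : ℕ) : ℝ)) ∈ (K : Subgroup (GL (Fin 2) ℝ)).strictPeriods := by simpa using h1K
  obtain ⟨Γ', g, ⟨N, hN, hle⟩, hg⟩ := hCDT K (k + 12 * (k' : ℤ)) fK 1 one_pos h1K' hint
  refine ⟨N, Nat.pos_of_ne_zero hN, fun γ hγ ↦ ?_⟩
  have h1 : f ∣[k + 12 * (k' : ℤ)] γ = f := by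
    have hmem : (Matrix.SpecialLinearGroup.mapGL ℝ γ : GL (Fin 2) ℝ) ∈ (Γ' : Subgroup (GL (Fin 2) ℝ)) :=
      Subgroup.mem_map_of_mem _ (hle hγ)
    have h := SlashInvariantForm.slash_action_eqn g _ hmem
    rw [hg] at h
    exact h
  rw [hfslash, hfmul] at h1
  funext τ
  have h2 := congrFun h1 τ
  simp only [Pi.mul_apply] at h2
  have hDne : Dk τ ≠ 0 := by rw [hDk]; exact pow_ne_zero _ (ModularForm.discriminant_ne_zero τ)
  exact mul_right_cancel₀ hDne h2

end Summit.BirchSwinnertonDyer.BirchSwinnertonDyer.Theorems.ManinLocalTwoThree.UDWOfCDT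

end
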